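import Summits.Ventures.Crystal3D.Theorems.StickyWulffConstantCoaxialWallLawVicinalCore
import HarnessLib

/-!
# The debt algebra of lane F: `CoaxialTwoSlabAdhesionOn S` and the COHERENT / INCOHERENT split of the vicinal core
# (crux `CoaxialWallLaw`, stmt-Ventures-19481, line `WallLedgerF`)

HONEST FRAMING. Venture `Summits/Ventures/Crystal3D` (cell `crystal3d-full`), helper `--supports` the crux `CoaxialWallLaw`
of `route-Ventures-StickyWulffConstant` (REGISTERED line `WallLedgerF`, open stub `stub_coaxialTwoSlabAdhesion`).  Book-keeping
by theorem (cf-p1 ROUTE §86(44) AM / §86(62) BE: «type the split as Props + proved re-assembly so census results plug in BY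
NAME»); rung credit; F-C1 not moved; NOT the crux; no census result is used or claimed here.

* `CoaxialTwoSlabAdhesionOn S` — the registered stub RESTRICTED to the co-axial pairs `(A₁,t₁,A₂,t₂)` satisfying a pair
  predicate `S` (hypotheses `hco`, `hne`, `S`; conclusion verbatim).  Algebra: `…On_of_stub` (nothing smuggled), `…On_mono`,
  **`…On_split`** (`On (S ∧ Q)` and `On (S ∧ ¬Q)` give `On S`), `…On_univ` (`On ⊤` is the stub).
* `VicinalPair` — the three hypotheses of `CoaxialTwoSlabAdhesionVicinal` as one predicate;
  `coaxialTwoSlabAdhesionVicinal_iff_on : CoaxialTwoSlabAdhesionVicinal ↔ CoaxialTwoSlabAdhesionOn VicinalPair`.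
* The offset classes: `CoherentTwinPair` (twin about a unit menu normal `ν` of grain 1 with `t₂ − t₁ ∈ A₁·Λ₀ + ℤ√(2/3)ν`, the
  DSC lattice of the Σ3 — the COHERENT twins, composition plane a lattice plane), `CoherentFaultPair` (equal linear lattices,
  `t₂ − t₁ ∈ A₁·(Λ₀ + ℤ√(2/3)n)` for a unit menu normal `n` — the eight Shockley / stacking-FAULT cosets of level ⅓).
* The three debts: **`CoaxialTwoSlabAdhesionCoherentTwin`** `:= On (Vicinal ∧ CoherentTwin)` (census STEP-2/3, twin rows),
  **`CoaxialTwoSlabAdhesionCoherentFault`** `:= On (Vicinal ∧ ¬CoherentTwin ∧ CoherentFault)` (basal-fault staircases),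
  **`CoaxialTwoSlabAdhesionIncoherent`** `:= On (Vicinal ∧ ¬CoherentTwin ∧ ¬CoherentFault)` (displaced twins with one wide
  slot, incoherent level-⅓ translation classes, deeper `3^{-j}` basal-tower offsets: 19481-p2's THIN/THICK programme, (F-loc));
  **`coaxialTwoSlabAdhesionVicinal_of_split`**: the three ⇒ the vicinal core; `…_of_vicinal`: each ⇐ the vicinal core.
WHAT THIS IS NOT: a proof of any part; F-C1 not moved.
-/

noncomputable section

namespace Summit.Ventures.Crystal3D.Theorems

open Summit.Ventures.Crystal3D Finset
open Summit.Ventures.Crystal3D.Cruxes.CoaxialWallLaw.WallLedgerF (CoaxialTwoSlabAdhesion)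
open Literature.MathematicalPhysics.StatisticalMechanics (fccStacking barlowStacking IsHaggSeq contactDeficiency)
open scoped InnerProductSpace

/-- A predicate on pairs of moved lattices `(A₁·Λ₀ + t₁, A₂·Λ₀ + t₂)`. -/
abbrev CoaxialPairPred : Type :=
  (EuclideanSpace ℝ (Fin 3) ≃ₗᵢ[ℝ] EuclideanSpace ℝ (Fin 3)) → EuclideanSpace ℝ (Fin 3) →
    (EuclideanSpace ℝ (Fin 3) ≃ₗᵢ[ℝ] EuclideanSpace ℝ (Fin 3)) → EuclideanSpace ℝ (Fin 3) → Prop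

/-- **`stub_coaxialTwoSlabAdhesion` RESTRICTED to the co-axial pairs satisfying `S`.** -/
def CoaxialTwoSlabAdhesionOn (S : CoaxialPairPred) : Prop :=
    ∀ (A₁ : EuclideanSpace ℝ (Fin 3) ≃ₗᵢ[ℝ] EuclideanSpace ℝ (Fin 3)) (t₁ : EuclideanSpace ℝ (Fin 3))
      (A₂ : EuclideanSpace ℝ (Fin 3) ≃ₗᵢ[ℝ] EuclideanSpace ℝ (Fin 3)) (t₂ : EuclideanSpace ℝ (Fin 3)),
    (∃ (L : EuclideanSpace ℝ (Fin 3) ≃ₗᵢ[ℝ] EuclideanSpace ℝ (Fin 3))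
        (s₁ s₂ : EuclideanSpace ℝ (Fin 3)) (σ σ' : ℤ → ℤ), IsHaggSeq σ ∧ IsHaggSeq σ' ∧
        (fun p => A₁ p + t₁) '' fccStacking 1 (Real.sqrt (2 / 3)) ⊆
          (fun p => L p + s₁) '' barlowStacking 1 (Real.sqrt (2 / 3)) σ ∧
        (fun p => A₂ p + t₂) '' fccStacking 1 (Real.sqrt (2 / 3)) ⊆
          (fun p => L p + s₂) '' barlowStacking 1 (Real.sqrt (2 / 3)) σ') →
    (fun p => A₁ p + t₁) '' fccStacking 1 (Real.sqrt (2 / 3)) ≠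
      (fun p => A₂ p + t₂) '' fccStacking 1 (Real.sqrt (2 / 3)) →
    S A₁ t₁ A₂ t₂ →
    ∃ (L : EuclideanSpace ℝ (Fin 3) ≃ₗᵢ[ℝ] EuclideanSpace ℝ (Fin 3))
        (s₁ s₂ : EuclideanSpace ℝ (Fin 3)) (σ σ' : ℤ → ℤ), IsHaggSeq σ ∧ IsHaggSeq σ' ∧
        (fun p => A₁ p + t₁) '' fccStacking 1 (Real.sqrt (2 / 3)) ⊆
          (fun p => L p + s₁) '' barlowStacking 1 (Real.sqrt (2 / 3)) σ ∧
        (fun p => A₂ p + t₂) '' fccStacking 1 (Real.sqrt (2 / 3)) ⊆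
          (fun p => L p + s₂) '' barlowStacking 1 (Real.sqrt (2 / 3)) σ' ∧
    ∃ C R₀ : ℝ, 1 ≤ R₀ ∧ ∀ h : ℝ, 0 ≤ h → ∀ ρ : ℝ, R₀ ≤ ρ →
      ∀ X P₁ P₂ : Finset (EuclideanSpace ℝ (Fin 3)),
      (∀ p ∈ X, ∀ q ∈ X, p ≠ q → 1 ≤ dist p q) → P₁ ⊆ X → P₂ ⊆ X \ P₁ →
      (∀ p ∈ X, -(2 * R₀) ≤ p 2 ∧ p 2 ≤ h + 2 * R₀ ∧ p 0 ^ 2 + p 1 ^ 2 ≤ ρ ^ 2) →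
      (∀ p, p ∈ P₁ ↔ (p ∈ (fun q => A₁ q + t₁) '' fccStacking 1 (Real.sqrt (2 / 3)) ∧
        -(2 * R₀) ≤ p 2 ∧ p 2 ≤ -R₀ ∧ p 0 ^ 2 + p 1 ^ 2 ≤ ρ ^ 2)) →
      (∀ p, p ∈ P₂ ↔ (p ∈ (fun q => A₂ q + t₂) '' fccStacking 1 (Real.sqrt (2 / 3)) ∧
        h + R₀ ≤ p 2 ∧ p 2 ≤ h + 2 * R₀ ∧ p 0 ^ 2 + p 1 ^ 2 ≤ ρ ^ 2)) →
      ((((P₁ ×ˢ (X \ P₁)).filter fun pq => dist pq.1 pq.2 = 1).card : ℕ) : ℝ) +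
        ((((P₂ ×ˢ ((X \ P₁) \ P₂)).filter fun pq => dist pq.1 pq.2 = 1).card : ℕ) : ℝ) ≤
        contactDeficiency ((X \ P₁) \ P₂) +
          (Real.sqrt 2 / 4 * ∑ᶠ w ∈ {w ∈ fccStacking 1 (Real.sqrt (2 / 3)) | ‖w‖ = 1},
              |⟪w, A₁.symm (EuclideanSpace.single (2 : Fin 3) (1 : ℝ))⟫_ℝ| +
            Real.sqrt 2 / 4 * ∑ᶠ w ∈ {w ∈ fccStacking 1 (Real.sqrt (2 / 3)) | ‖w‖ = 1},
              |⟪w, A₂.symm (EuclideanSpace.single (2 : Fin 3) (1 : ℝ))⟫_ℝ| -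
            (1 / 2 : ℝ) * Real.sqrt (1 - ⟪L (EuclideanSpace.single (2 : Fin 3) (1 : ℝ)),
              (EuclideanSpace.single (2 : Fin 3) (1 : ℝ))⟫_ℝ ^ 2)) * Real.pi * ρ ^ 2 +
          C * (1 + h) * ρ

/-! ### Algebra of restricted debts -/

/-- Nothing is smuggled: the stub implies every restriction. -/
theorem coaxialTwoSlabAdhesionOn_of_stub (S : CoaxialPairPred) (h : CoaxialTwoSlabAdhesion) :
    CoaxialTwoSlabAdhesionOn S :=
  fun A₁ t₁ A₂ t₂ hco hne _ => h A₁ t₁ A₂ t₂ hco hne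

/-- Monotonicity: a debt on a larger class pays a debt on a smaller class. -/
theorem coaxialTwoSlabAdhesionOn_mono {S T : CoaxialPairPred} (hTS : ∀ A₁ t₁ A₂ t₂, T A₁ t₁ A₂ t₂ → S A₁ t₁ A₂ t₂)
    (h : CoaxialTwoSlabAdhesionOn S) : CoaxialTwoSlabAdhesionOn T :=
  fun A₁ t₁ A₂ t₂ hco hne hT => h A₁ t₁ A₂ t₂ hco hne (hTS A₁ t₁ A₂ t₂ hT)

/-- **Splitting a debt along a predicate.** -/
theorem coaxialTwoSlabAdhesionOn_split {S : CoaxialPairPred} (Q : CoaxialPairPred)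
    (h₁ : CoaxialTwoSlabAdhesionOn fun A₁ t₁ A₂ t₂ => S A₁ t₁ A₂ t₂ ∧ Q A₁ t₁ A₂ t₂)
    (h₂ : CoaxialTwoSlabAdhesionOn fun A₁ t₁ A₂ t₂ => S A₁ t₁ A₂ t₂ ∧ ¬ Q A₁ t₁ A₂ t₂) :
    CoaxialTwoSlabAdhesionOn S := by
  intro A₁ t₁ A₂ t₂ hco hne hS
  by_cases hQ : Q A₁ t₁ A₂ t₂
  · exact h₁ A₁ t₁ A₂ t₂ hco hne ⟨hS, hQ⟩
  · exact h₂ A₁ t₁ A₂ t₂ hco hne ⟨hS, hQ⟩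

/-- The unrestricted debt is the stub. -/
theorem coaxialTwoSlabAdhesionOn_univ_iff : CoaxialTwoSlabAdhesionOn (fun _ _ _ _ => True) ↔ CoaxialTwoSlabAdhesion :=
  ⟨fun h A₁ t₁ A₂ t₂ hco hne => h A₁ t₁ A₂ t₂ hco hne trivial, fun h => coaxialTwoSlabAdhesionOn_of_stub _ h⟩

/-! ### The vicinal core as a restricted debt -/

/-- **The vicinal pair predicate**: the three hypotheses of `CoaxialTwoSlabAdhesionVicinal` (triadic offset; twins vicinal;
level ⅓ ⇒ registered for every wide slot dominating an admissible axis). -/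
def VicinalPair : CoaxialPairPred := fun A₁ t₁ A₂ t₂ =>
    (∃ j : ℕ, ((3 : ℝ) ^ j) • A₁.symm (t₂ - t₁) ∈ fccStacking 1 (Real.sqrt (2 / 3))) ∧
    (∀ ν : EuclideanSpace ℝ (Fin 3), ‖ν‖ = 1 →
      (∀ w ∈ fccSlots, ⟪A₁ w, ν⟫_ℝ = 0 ∨ ⟪A₁ w, ν⟫_ℝ = Real.sqrt (2 / 3) ∨ ⟪A₁ w, ν⟫_ℝ = -Real.sqrt (2 / 3)) →
      A₂ '' fccStacking 1 (Real.sqrt (2 / 3)) = twinFrame A₁ ν '' fccStacking 1 (Real.sqrt (2 / 3)) →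
      Real.sqrt 3 / 2 * Real.sqrt (1 - ⟪ν, EuclideanSpace.single (2 : Fin 3) (1 : ℝ)⟫_ℝ ^ 2) < 9 / 20) ∧
    (A₁.symm ((3 : ℝ) • (t₂ - t₁)) ∈ fccStacking 1 (Real.sqrt (2 / 3)) →
      ∀ m : EuclideanSpace ℝ (Fin 3), ‖m‖ = 1 →
      (∀ w ∈ fccSlots, ⟪A₁ w, m⟫_ℝ = 0 ∨ ⟪A₁ w, m⟫_ℝ = Real.sqrt (2 / 3) ∨ ⟪A₁ w, m⟫_ℝ = -Real.sqrt (2 / 3)) →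
      (A₂ '' fccStacking 1 (Real.sqrt (2 / 3)) = A₁ '' fccStacking 1 (Real.sqrt (2 / 3)) ∨
        A₂ '' fccStacking 1 (Real.sqrt (2 / 3)) = twinFrame A₁ m '' fccStacking 1 (Real.sqrt (2 / 3))) →
      ∀ u₁ ∈ fccSlots, (9 / 20 : ℝ) ≤ ⟪A₁ u₁, EuclideanSpace.single (2 : Fin 3) (1 : ℝ)⟫_ℝ →
      Real.sqrt (1 - ⟪m, EuclideanSpace.single (2 : Fin 3) (1 : ℝ)⟫_ℝ ^ 2) ≤
        Real.sqrt 2 * ⟪A₁ u₁, EuclideanSpace.single (2 : Fin 3) (1 : ℝ)⟫_ℝ →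
      ∀ n₁ : EuclideanSpace ℝ (Fin 3), ‖n₁‖ = 1 →
      (∀ w ∈ fccSlots, ⟪A₁ w, n₁⟫_ℝ = 0 ∨ ⟪A₁ w, n₁⟫_ℝ = Real.sqrt (2 / 3) ∨ ⟪A₁ w, n₁⟫_ℝ = -Real.sqrt (2 / 3)) →
      ⟪A₁ u₁, n₁⟫_ℝ = Real.sqrt (2 / 3) →
      (A₂ '' fccStacking 1 (Real.sqrt (2 / 3)) = A₁ '' fccStacking 1 (Real.sqrt (2 / 3)) ∨
        A₂ '' fccStacking 1 (Real.sqrt (2 / 3)) = twinFrame A₁ n₁ '' fccStacking 1 (Real.sqrt (2 / 3))) →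
      ∃ a b : ℤ, A₁.symm (t₂ - t₁ - (a : ℝ) • (Real.sqrt (2 / 3) • n₁) -
        (b : ℝ) • (Real.sqrt (2 / 3) • ((2 * Real.sqrt (2 / 3)) • A₁ u₁ - n₁))) ∈ fccStacking 1 (Real.sqrt (2 / 3)))

/-- The vicinal core is the debt restricted to vicinal pairs. -/
theorem coaxialTwoSlabAdhesionVicinal_iff_on :
    CoaxialTwoSlabAdhesionVicinal ↔ CoaxialTwoSlabAdhesionOn VicinalPair :=
  ⟨fun h A₁ t₁ A₂ t₂ hco hne hS => h A₁ t₁ A₂ t₂ hco hne hS.1 hS.2.1 hS.2.2,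
    fun h A₁ t₁ A₂ t₂ hco hne h₁ h₂ h₃ => h A₁ t₁ A₂ t₂ hco hne ⟨h₁, h₂, h₃⟩⟩

/-! ### The offset classes -/

/-- **Coherent twin pair**: grain 2's linear lattice is grain 1's mirror twin about a unit menu normal `ν` of grain 1 and the
offset lies in the DSC lattice `A₁·Λ₀ + ℤ√(2/3)ν` of that Σ3 (the composition plane can be a common lattice plane). -/
def CoherentTwinPair : CoaxialPairPred := fun A₁ t₁ A₂ t₂ =>
    ∃ ν : EuclideanSpace ℝ (Fin 3), ‖ν‖ = 1 ∧
      (∀ w ∈ fccSlots, ⟪A₁ w, ν⟫_ℝ = 0 ∨ ⟪A₁ w, ν⟫_ℝ = Real.sqrt (2 / 3) ∨ ⟪A₁ w, ν⟫_ℝ = -Real.sqrt (2 / 3)) ∧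
      A₂ '' fccStacking 1 (Real.sqrt (2 / 3)) = twinFrame A₁ ν '' fccStacking 1 (Real.sqrt (2 / 3)) ∧
      ∃ a : ℤ, A₁.symm (t₂ - t₁ - (a : ℝ) • (Real.sqrt (2 / 3) • ν)) ∈ fccStacking 1 (Real.sqrt (2 / 3))

/-- **Coherent fault pair**: equal linear lattices and the offset in a Shockley / stacking-fault coset `A₁·(Λ₀ + ℤ√(2/3)n)` of a
unit menu normal `n` of grain 1 (level ⅓, coherent). -/
def CoherentFaultPair : CoaxialPairPred := fun A₁ t₁ A₂ t₂ =>
    A₂ '' fccStacking 1 (Real.sqrt (2 / 3)) = A₁ '' fccStacking 1 (Real.sqrt (2 / 3)) ∧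
    ∃ n : EuclideanSpace ℝ (Fin 3), ‖n‖ = 1 ∧
      (∀ w ∈ fccSlots, ⟪A₁ w, n⟫_ℝ = 0 ∨ ⟪A₁ w, n⟫_ℝ = Real.sqrt (2 / 3) ∨ ⟪A₁ w, n⟫_ℝ = -Real.sqrt (2 / 3)) ∧
      ∃ a : ℤ, A₁.symm (t₂ - t₁ - (a : ℝ) • (Real.sqrt (2 / 3) • n)) ∈ fccStacking 1 (Real.sqrt (2 / 3))

/-! ### The three debts and the re-assembly -/

/-- **Debt 1 — vicinal COHERENT TWINS** (census STEP-2/3: twin rows). -/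
def CoaxialTwoSlabAdhesionCoherentTwin : Prop :=
  CoaxialTwoSlabAdhesionOn fun A₁ t₁ A₂ t₂ => VicinalPair A₁ t₁ A₂ t₂ ∧ CoherentTwinPair A₁ t₁ A₂ t₂

/-- **Debt 2 — vicinal COHERENT FAULTS** (basal stacking-fault staircases; census STEP-2/3: translation rows). -/
def CoaxialTwoSlabAdhesionCoherentFault : Prop :=
  CoaxialTwoSlabAdhesionOn fun A₁ t₁ A₂ t₂ =>
    (VicinalPair A₁ t₁ A₂ t₂ ∧ ¬ CoherentTwinPair A₁ t₁ A₂ t₂) ∧ CoherentFaultPair A₁ t₁ A₂ t₂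

/-- **Debt 3 — the INCOHERENT vicinal pairs** (displaced twins with a single wide slot, incoherent level-⅓ translation classes,
deeper `3^{-j}` basal-tower offsets: THIN/THICK, (F-loc)). -/
def CoaxialTwoSlabAdhesionIncoherent : Prop :=
  CoaxialTwoSlabAdhesionOn fun A₁ t₁ A₂ t₂ =>
    (VicinalPair A₁ t₁ A₂ t₂ ∧ ¬ CoherentTwinPair A₁ t₁ A₂ t₂) ∧ ¬ CoherentFaultPair A₁ t₁ A₂ t₂

/-- **Re-assembly**: the three debts give the vicinal core. -/
theorem coaxialTwoSlabAdhesionVicinal_of_split (h₁ : CoaxialTwoSlabAdhesionCoherentTwin)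
    (h₂ : CoaxialTwoSlabAdhesionCoherentFault) (h₃ : CoaxialTwoSlabAdhesionIncoherent) :
    CoaxialTwoSlabAdhesionVicinal :=
  coaxialTwoSlabAdhesionVicinal_iff_on.2
    (coaxialTwoSlabAdhesionOn_split CoherentTwinPair h₁ (coaxialTwoSlabAdhesionOn_split CoherentFaultPair h₂ h₃))

/-- Nothing is smuggled: each debt is implied by the vicinal core. -/
theorem split_of_coaxialTwoSlabAdhesionVicinal (h : CoaxialTwoSlabAdhesionVicinal) :
    CoaxialTwoSlabAdhesionCoherentTwin ∧ CoaxialTwoSlabAdhesionCoherentFault ∧ CoaxialTwoSlabAdhesionIncoherent := by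
  have h' := coaxialTwoSlabAdhesionVicinal_iff_on.1 h
  exact ⟨coaxialTwoSlabAdhesionOn_mono (fun _ _ _ _ hT => hT.1) h',
    coaxialTwoSlabAdhesionOn_mono (fun _ _ _ _ hT => hT.1.1) h',
    coaxialTwoSlabAdhesionOn_mono (fun _ _ _ _ hT => hT.1.1) h'⟩

open scoped Classical in
/-- **The registered stub IN FULL from E1, `StarPairFar` and the three debts.** -/
theorem coaxialTwoSlabAdhesion_of_split
    {s₀ : EuclideanSpace ℝ (Fin 3)} (hs₀ : s₀ ∈ fccSlots)
    (hcert : ExactOnly 0 (fccSlots.filter fun w => 0 < ⟪w, s₀⟫_ℝ)) (hSP : StarPairFar)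
    (h₁ : CoaxialTwoSlabAdhesionCoherentTwin) (h₂ : CoaxialTwoSlabAdhesionCoherentFault)
    (h₃ : CoaxialTwoSlabAdhesionIncoherent) : CoaxialTwoSlabAdhesion :=
  coaxialTwoSlabAdhesion_of_vicinal hs₀ hcert hSP (coaxialTwoSlabAdhesionVicinal_of_split h₁ h₂ h₃)

end Summit.Ventures.Crystal3D.Theorems

end
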